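import Summits.SmoothPoincare4.SmoothPoincare4.Theorems.EntropyRungBakryEmeryLogSobolevGaffneyCutoff
import HarnessLib

/-!
# The kinematic identity `∂ₜ|∇f_t|² = 2 g⁻¹(df_t, dḟ_t)` for a static metric
# (support item `EntropyRung.BakryEmeryLogSobolev`, stmt-SmoothPoincare4-16587)

For a family `f` smooth on `M × S` (`S` a time set with unique derivatives,
`S ⊆ closure (interior S)`) on a manifold modelled on `ℝⁿ` with a (static) metric `g`, the
derivative within `S` of `|∇f_t|²(x)` is `2 g⁻¹(df_t, dḟ_t)(x)`, `ḟ_t(y) = derivWithin (f · y) S t` —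
the manifold reading of `MetricCoord.IsMetricOn.hasDerivWithinAt_gradSqAt_static` through the chart
bridges of `BakryEmeryHeatFlow.lean` (compare `deriv_gradSq_of_heatFlow_isOpen`, which substitutes the
heat equation). Used by the first-order Fisher dissipation inequality
(`EntropyRungBakryEmeryLogSobolevFisherPointwise.lean`). Everything is proved; no definitions.

## References

* [Topping2006] P. Topping, *Lectures on the Ricci flow* (2006), proof of Prop. 6.2.1 (static case).
* [CarrilloNi2009] J. A. Carrillo, L. Ni, Comm. Anal. Geom. 17 (2009), §3 (p. 8).
-/

noncomputable section

set_option linter.dupNamespace false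

open scoped Manifold ContDiff ENNReal NNReal Topology
open MeasureTheory Set Filter
open Literature.Geometry.Lorentzian Literature.Geometry.Riemannian

namespace Summit.SmoothPoincare4.SmoothPoincare4.Theorems.BakryEmeryComplete

section Kinematic

variable {n : ℕ} {M : Type*} [TopologicalSpace M] [ChartedSpace (EuclideanSpace ℝ (Fin n)) M]
  [IsManifold (𝓡 n) ∞ M]
  {g : PseudoRiemannianMetric (𝓡 n) ∞ (EuclideanSpace ℝ (Fin n)) (TangentSpace (𝓡 n) : M → Type _)}

/-- **`∂ₜ|∇f_t|² = 2 g⁻¹(df_t, dḟ_t)` for a static metric** (general time set `S` with unique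
derivatives and `S ⊆ closure (interior S)`, `ḟ` the derivative within `S`): the chart computation of
`MetricCoord.IsMetricOn.hasDerivWithinAt_gradSqAt_static`; `ḟ(t, ·)` is smooth
(`contMDiffOn_derivWithin_time_of_uniqueDiffOn`). [folklore] -/
theorem derivWithin_gradSq_eq_two_innerDual {f : ℝ → M → ℝ} {S : Set ℝ} (hS : UniqueDiffOn ℝ S)
    (hS' : S ⊆ closure (interior S))
    (hf : ContMDiffOn ((𝓡 n).prod 𝓘(ℝ, ℝ)) 𝓘(ℝ, ℝ) ∞ (fun p : M × ℝ ↦ f p.2 p.1) (univ ×ˢ S))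
    {t : ℝ} (ht : t ∈ S) (x : M) :
    derivWithin (fun s ↦ g.gradSq (f s) x) S t =
      2 * g.innerDual x (mvfderiv (𝓡 n) (f t) x).toLinearMap
        (mvfderiv (𝓡 n) (fun y ↦ derivWithin (fun s ↦ f s y) S t) x).toLinearMap := by
  -- the chart at `x`
  set G := chartRep (𝓡 n) (fun _ ↦ g) x 0 with hGdef
  have hGm : MetricCoord.IsMetricOn G (extChartAt (𝓡 n) x).target :=
    OpensChart.isMetricOn_repr (val_chartPullback_eq_chartRep (fun _ : ℝ ↦ g) x 0)
  set Fh : ℝ → EuclideanSpace ℝ (Fin n) → ℝ := fun s z ↦ f s ((extChartAt (𝓡 n) x).symm z)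
    with hFhdef
  have hu0 : extChartAt (𝓡 n) x x ∈ (extChartAt (𝓡 n) x).target := mem_extChartAt_target x
  set u₀ : chartTarget (𝓡 n) x := ⟨extChartAt (𝓡 n) x x, hu0⟩ with hu₀def
  have hΦu₀ : chartInv (𝓡 n) x u₀ = x := extChartAt_to_inv x
  have hslice : ∀ s ∈ S, ContMDiff (𝓡 n) 𝓘(ℝ, ℝ) ∞ (f s) := fun s hs ↦
    contMDiff_slice_of_contMDiffOn hf hs
  have hFh : ContDiffOn ℝ ∞ (fun p : EuclideanSpace ℝ (Fin n) × ℝ ↦ Fh p.2 p.1)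
      ((extChartAt (𝓡 n) x).target ×ˢ S) :=
    contDiffOn_family_comp_extChartAt_symm hf x
  have hft : ContMDiff (𝓡 n) 𝓘(ℝ, ℝ) ∞ (f t) := hslice t ht
  have hfd : ∀ y, MDifferentiableAt (𝓡 n) 𝓘(ℝ, ℝ) (f t) y := fun y ↦ hft.mdifferentiableAt (by simp)
  -- the time derivative `ḟ(t, ·)` is smooth
  have hdotfam := contMDiffOn_derivWithin_time_of_uniqueDiffOn (I := 𝓡 n) (u := f) hS hf
  have hdot : ContMDiff (𝓡 n) 𝓘(ℝ, ℝ) ∞ (fun y ↦ derivWithin (fun s ↦ f s y) S t) :=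
    hdotfam.comp_contMDiff (contMDiff_id.prodMk contMDiff_const) fun y ↦ ⟨mem_univ _, ht⟩
  have hdotd : MDifferentiableAt (𝓡 n) 𝓘(ℝ, ℝ) (fun y ↦ derivWithin (fun s ↦ f s y) S t)
      (chartInv (𝓡 n) x u₀) := hdot.mdifferentiableAt (by simp)
  -- (a) `|∇f_s|²(x)` read in the chart, for `s ∈ S`
  have hgrad : ∀ s ∈ S, g.gradSq (f s) x = MetricCoord.gradSqAt G (Fh s) (extChartAt (𝓡 n) x x) := by
    intro s hs
    have h := gradSq_chartInv_eq g x u₀ (F := f s) ((hslice s hs).mdifferentiableAt (by simp))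
    rw [hΦu₀] at h
    exact h
  have hderiv : derivWithin (fun s ↦ g.gradSq (f s) x) S t =
      derivWithin (fun s ↦ MetricCoord.gradSqAt G (Fh s) (extChartAt (𝓡 n) x x)) S t :=
    derivWithin_congr (fun s hs ↦ hgrad s hs) (hgrad t ht)
  -- (b) the coordinate time derivative
  have hcoord := (hGm.hasDerivWithinAt_gradSqAt_static hS hS' hFh hu0 ht).derivWithin (hS t ht)
  -- (c) `ḟ` in the chart is the representative of `ḟ(t, ·)`
  have hrep : MetricCoord.tDerivFun Fh S t =
      ((fun y ↦ derivWithin (fun s ↦ f s y) S t) ∘ (extChartAt (𝓡 n) x).symm) := by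
    funext z
    simp only [MetricCoord.tDerivFun, Function.comp_apply, hFhdef]
  -- (d) the bridge for `g⁻¹(df, dḟ)`
  have hI : g.innerDual x (mvfderiv (𝓡 n) (f t) x).toLinearMap
      (mvfderiv (𝓡 n) (fun y ↦ derivWithin (fun s ↦ f s y) S t) x).toLinearMap =
      fderiv ℝ (MetricCoord.tDerivFun Fh S t) (extChartAt (𝓡 n) x x)
        (MetricCoord.sharpAt G (extChartAt (𝓡 n) x x) (fderiv ℝ (Fh t) (extChartAt (𝓡 n) x x))) := by
    have h := innerDual_chartInv_eq g x u₀ (hfd _) hdotd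
    rw [hΦu₀] at h
    rw [show (mvfderiv (𝓡 n) (f t) x).toLinearMap = (mvfderiv (𝓡 n) (f t) x : TangentSpace (𝓡 n) x →ₗ[ℝ] ℝ)
        from rfl,
      show (mvfderiv (𝓡 n) (fun y ↦ derivWithin (fun s ↦ f s y) S t) x).toLinearMap =
        (mvfderiv (𝓡 n) (fun y ↦ derivWithin (fun s ↦ f s y) S t) x : TangentSpace (𝓡 n) x →ₗ[ℝ] ℝ)
        from rfl, h,
      MetricCoord.apply_sharpAt_comm (hGm.isInvertible _ hu0) (hGm.symm _ hu0), hrep]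
    rfl
  rw [hderiv, hcoord, hI]

end Kinematic

end Summit.SmoothPoincare4.SmoothPoincare4.Theorems.BakryEmeryComplete

end
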